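import Literature.Analysis.FluidPDE.SereginSverakMeridionalAxisDecay
import Literature.Analysis.FluidPDE.KNSSPoloidalAxisDecay
import HarnessLib

/-!
# Seregin–Šverák 2009, Theorem 1.1 with the rate on the meridional velocity only:
# the classical reading, unconditional

G. Seregin, V. Šverák, *On Type I singularities of the local axi-symmetric solutions of the
Navier–Stokes equations*, Comm. PDE 34 (2009) 171–201 = arXiv:0804.1803, Theorem 1.1 (p. 3) with
hypothesis (1.1) (p. 2): an axis point `z₀` of an axially symmetric weak solution is regular as
soon as `√(t₀ - t)|v̄|` is bounded near `z₀`, `v̄ = v_ϱ e_ϱ + v₃ e₃` the MERIDIONAL part. The tree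
records this as the named fact `SereginSverak2009.MeridionalTypeIRegularity`
(`SereginSverakMeridionalTypeI.lean`, with its classical corollaries CONDITIONAL on the fact) and
proves it GIVEN the swirl bound (as7) `|Γ| ≤ C₂` on `Q`
(`SereginSverak2009.isRegularAtOrigin_of_meridionalTypeI_of_swirlBound`,
`SereginSverakMeridionalAxisDecay.lean`; in print (as7) is Lemma 3.3, App. II).

For CLASSICAL solutions on `ℝ³ × [0, T)` the swirl bound is free: `Γ = ϱ u_φ` obeys the maximum
principle `|Γ(t, x)| ≤ sup|Γ₀|` (KNSS 2009 (1.9); the tree's `abs_swirl_le_of_classical_Ico`,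
DISCHARGED), and `Γ` is invariant under the Navier–Stokes zoom about an axis point
(`SereginSverak2009.swirl_axis_zoom`). This file therefore PROVES, with no reference to the named
fact, the classical corollaries of Theorem 1.1 under the single extra datum hypothesis
`Γ₀ = ϱ u₀^θ ∈ L^∞` (automatic for rapidly decaying data, `HasRapidSpatialDecay.abs_swirl_le`):

* `SereginSverak2009.isBoundedNearTop_axis_of_localMeridionalTypeI_of_swirlBound` — under the
  Type-I-free standing hypotheses `AxisymmetricL3Hyp ν T u p`, the poloidal rate
  `√(T - t)‖ū(t,x)‖ ≤ C` on a parabolic neighbourhood `]T-δ²,T[ × B(x₀,δ)` of an axis point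
  `(T, x₀)` (the paper's (1.1) is local) and a swirl bound `|Γ(t,x)| ≤ M` on `[0,T) × ℝ³`, the
  point `(T, x₀)` is regular (proof = that of `MeridionalTypeIRegularity.isBoundedNearTop_axis` on
  a cylinder of size `min(√T, δ)/2`, the fact replaced by the theorem, the zoomed swirl bound
  supplied by `swirl_axis_zoom`); `…_of_meridionalTypeI_of_swirlBound` (rate on `[0,T) × ℝ³`),
  `…_of_swirl₀` (from `|Γ₀| ≤ M` by the maximum principle); local kill forms
  `exists_sqrt_mul_norm_poloidal_gt_near_axis_of_not_isBoundedNearTop` / `_of_swirl₀`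
  (a singular axis point sees unbounded `√(T - t)‖ū‖` in every parabolic neighbourhood);
* `SereginSverak2009.exists_bound_Ico_of_meridionalTypeI` — boundedness on `[0,T) × ℝ³`
  (off-axis and spatial-infinity inputs and the compactness glue of `AxisymmetricL3OffTube`);
* `SereginSverak2009.hasSmoothExtensionPast_of_meridionalTypeI` (+ `_of_rapidDecay`,
  `_of_isTypeIBlowup_poloidal`) — NO BLOW-UP at `T` for a classical axisymmetric Leray–Hopf
  solution, bounded on sub-slabs, with `Γ₀ ∈ L^∞`, whose POLOIDAL velocity obeys the Type I rate;
* `SereginSverak2009.exists_sqrt_mul_norm_poloidal_gt_of_isMaximalSmoothSolution`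
  (+ `_of_rapidDecay`) — kill form: at a genuine lifespan `T`, `√(T - t)‖ū(t,x)‖` is unbounded.
* `SereginSverak2009.exists_bound_Ico_of_localMeridionalTypeI`,
  `…hasSmoothExtensionPast_of_localMeridionalTypeI`,
  `…exists_axisPoint_meridionalTypeII_of_isMaximalSmoothSolution` (+ `_of_rapidDecay`) — the
  sharpest classical reading: a genuine lifespan needs an AXIS POINT at which `√(T - t)‖ū‖` is
  unbounded in every parabolic neighbourhood.
* `AxisymmetricL3Hyp.isBoundedNearTop_axis_of_zoom` — the zoom about an axis point as a TOOL
  (any local regularity criterion at the origin for the zoomed pair gives boundedness near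
  `(T, x₀)`), and with it Theorem 1.2 localised and classical:
  `SereginSverak2009.isBoundedNearTop_axis_of_localPoloidalAxisDecay_of_swirlBound`
  (`|x'|‖ū‖ ≤ C` near `(T, x₀)` + `|Γ| ≤ M` ⇒ regular; from the tree's
  `isRegularAtOrigin_of_poloidalAxisDecay`), its local kill form and the axis-point kill form
  `exists_axisPoint_poloidalAxisDecay_unbounded_of_isMaximalSmoothSolution`.
* `knss_no_axisymmetric_typeI_poloidal` (+ `_of_rapidDecay`) — the sibling of the tree's
  `knss_no_axisymmetric_typeI` with BOTH alternatives on the poloidal velocity (one name for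
  the census row).

No named facts are introduced. WHAT THIS IS NOT: not a statement about general (non-classical,
or `Γ₀ ∉ L^∞`) weak solutions — for those Theorem 1.1 remains the named fact
`MeridionalTypeIRegularity` (Lemma 3.3 not formalised).

## References

* G. Seregin, V. Šverák, Comm. PDE 34 (2009) 171–201, arXiv:0804.1803: §1 (1.1), Thm 1.1
  (pp. 2–3); §3 Lemma 3.3 (as1), Lemma 3.5, Prop. 3.7 (pp. 9–10); §4 (p. 11).
  [`SereginSverak2009`]
* G. Koch, N. Nadirashvili, G. Seregin, V. Šverák, Acta Math. 203 (2009) 83–105: (1.9) (the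
  maximum principle for `Γ`), Thm 5.3, Thm 6.2. [`KochNadirashviliSereginSverak2009`]
-/

noncomputable section

open MeasureTheory Set Function Filter Topology TopologicalSpace Metric
open scoped NNReal ENNReal

namespace Literature.Analysis.FluidPDE

open Literature.Barriers.NavierStokesRegularity

section Classical

open SereginSverak2009

variable {ν T : ℝ} {u : ℝ → EuclideanSpace ℝ (Fin 3) → EuclideanSpace ℝ (Fin 3)}
  {p : ℝ → EuclideanSpace ℝ (Fin 3) → ℝ}

/-- **An axis point is regular under a LOCAL meridional Type I rate and a swirl bound —
classical, unconditional** (Seregin–Šverák 2009, Thm. 1.1, classical reading; the paper's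
hypothesis (1.1) is local: "`sup_{Q(z₀,R)} √(t₀ - t)|v̄| < +∞` for some `R > 0`"): under the
Type-I-free standing hypotheses `AxisymmetricL3Hyp ν T u p` (classical solution on `ℝ³ × [0, T)`,
Leray–Hopf, bounded on sub-slabs, axisymmetric), the rate `√(T - t) ‖ū(t, x)‖ ≤ C` on the
POLOIDAL part in some parabolic neighbourhood `]T - δ², T[ × B(x₀, δ)` of the axis point `(T, x₀)`,
and the swirl bound `|Γ(t, x)| ≤ M` on `[0, T) × ℝ³`, `u` is bounded on a backward parabolic
neighbourhood of `(T, x₀)`. PROOF: that of `MeridionalTypeIRegularity.isBoundedNearTop_axis` —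
gauged pressure, viscosity-normalising zoom `v(s,y) = α u(T + βs, x₀ + Ry)` of a cylinder
`Q((T,x₀), ρ)`, `ρ = min(√T, δ)/2`, onto the unit cylinder, `L³`/`L^{3/2}` classes, axisymmetry,
(r2) from the sub-slab bounds, (1.1) through `poloidalPart_axis_zoom` — plus (as7) for `v`:
`Γ[v(s)](y) = (α/R) Γ[u(T+βs)](x₀ + Ry)` (`swirl_axis_zoom`); then the THEOREM
`isRegularAtOrigin_of_meridionalTypeI_of_swirlBound` in place of the named fact, transported
back by `AxisymmetricL3Hyp.isBoundedNearTop_of_eLpNorm_rescaled_lt_top`.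
[cite: SereginSverak2009, Thm 1.1 (arXiv p. 3) with (1.1) (p. 2), Lemma 3.3 (as1) (p. 9), §3–§4] -/
theorem SereginSverak2009.isBoundedNearTop_axis_of_localMeridionalTypeI_of_swirlBound
    (H : AxisymmetricL3Hyp ν T u p) (x₀ : EuclideanSpace ℝ (Fin 3)) (hx₀ : cylRadius x₀ = 0)
    {δ C : ℝ} (hδ : 0 < δ)
    (hmer : ∀ t ∈ Ico 0 T, T - δ ^ 2 < t → ∀ x ∈ ball x₀ δ,
      Real.sqrt (T - t) * ‖poloidalPart (u t) x‖ ≤ C)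
    (hΓ : ∃ M : ℝ, ∀ t ∈ Ico 0 T, ∀ x, |swirl (u t) x| ≤ M) : IsBoundedNearTop u T x₀ := by
  have hν := H.viscosity_pos
  have hT := H.time_pos
  -- scales: `R > 0` with `ρ = R (2 + 1/√ν) = min(√T, δ) / 2`
  set κ : ℝ := 2 + (Real.sqrt ν)⁻¹ with hκ
  have hκpos : 0 < κ := by positivity
  set L : ℝ := min (Real.sqrt T) δ with hL
  have hLpos : 0 < L := lt_min (Real.sqrt_pos.2 hT) hδ
  have hLT : L ≤ Real.sqrt T := min_le_left _ _
  have hLδ : L ≤ δ := min_le_right _ _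
  set R : ℝ := L / (2 * κ) with hR
  have hRpos : 0 < R := by positivity
  set ρ : ℝ := R * κ with hρ
  have hρL : ρ = L / 2 := by rw [hρ, hR]; field_simp
  have hρT : ρ ^ 2 ≤ T := by
    rw [hρL, div_pow]
    have h1 : L ^ 2 ≤ T := by
      calc L ^ 2 ≤ Real.sqrt T ^ 2 := pow_le_pow_left₀ hLpos.le hLT 2
        _ = T := Real.sq_sqrt hT.le
    linarith
  have hρδ : ρ ≤ δ := by rw [hρL]; linarith
  set α : ℝ := R / ν with hα
  set β : ℝ := R ^ 2 / ν with hβdef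
  have hαpos : 0 < α := by positivity
  have hβpos : 0 < β := by positivity
  have hβeq : β = α * R := by rw [hβdef, hα]; field_simp
  have hβρ : β ≤ ρ ^ 2 := by
    have h1 : β = (R * (Real.sqrt ν)⁻¹) ^ 2 := by
      rw [hβdef, mul_pow, inv_pow, Real.sq_sqrt hν.le, div_eq_mul_inv]
    rw [h1, hρ]
    have h2 : (Real.sqrt ν)⁻¹ ≤ κ := by rw [hκ]; linarith
    exact pow_le_pow_left₀ (by positivity) (mul_le_mul_of_nonneg_left h2 hRpos.le) 2
  have hβT : β ≤ T := hβρ.trans hρT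
  have h2Rρ : 2 * R ≤ ρ := by
    rw [hρ, hκ]
    have : 0 ≤ (Real.sqrt ν)⁻¹ := by positivity
    nlinarith
  -- the gauged pressure and the physical cylinder
  obtain ⟨q, hsuit, hqae, -⟩ := H.exists_gauged_pressure
  have hPopen := isOpen_image_stAffine_ssCylinder (T := T) (x₀ := x₀) hβpos.ne' hRpos.ne'
  set PO : Opens (ℝ × EuclideanSpace ℝ (Fin 3)) := ⟨stAffine β R T x₀ '' ssCylinder, hPopen⟩
    with hPO
  have hPcyl : (PO : Set (ℝ × EuclideanSpace ℝ (Fin 3))) ⊆ parabolicCylinder ρ ((T : ℝ), x₀) :=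
    image_stAffine_ssCylinder_subset hβpos hRpos hβρ h2Rρ
  have hcylslab : parabolicCylinder ρ ((T : ℝ), x₀) ⊆
      Ioo 0 T ×ˢ (univ : Set (EuclideanSpace ℝ (Fin 3))) := by
    intro z hz
    rw [mem_parabolicCylinder] at hz
    exact ⟨⟨by nlinarith [hz.1.1], hz.1.2⟩, mem_univ _⟩
  have hPslab : (PO : Set (ℝ × EuclideanSpace ℝ (Fin 3))) ⊆
      Ioo 0 T ×ˢ (univ : Set (EuclideanSpace ℝ (Fin 3))) := hPcyl.trans hcylslab
  -- the rescaled pair solves the unit-viscosity system in distributions on the unit cylinder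
  have hdist : IsDistributionalNSSolutionOn (parCylOpens 0 1) 1 0 (α • stPull β R T x₀ u)
      (α ^ 2 • stPull β R T x₀ q) := by
    have h0 := ((hsuit PO hPslab).distributional).stRescale hαpos hRpos hβeq T x₀
    have hvisc : α * ν / R = 1 := by
      rw [hα, div_mul_cancel₀ R hν.ne', div_self hRpos.ne']
    have hforce : ((α ^ 2 * R) • stPull β R T x₀
        (0 : ℝ → EuclideanSpace ℝ (Fin 3) → EuclideanSpace ℝ (Fin 3))) = 0 := by
      funext s y; simp [stPull]
    rw [hvisc, hforce, stPreimage_image_ssCylinder hβpos.ne' hRpos.ne' hPopen,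
      ssCylinderOpens_eq_parCylOpens] at h0
    exact h0
  -- `v ∈ L³(Q)`
  have hpre : stAffine β R T x₀ ⁻¹' (PO : Set (ℝ × EuclideanSpace ℝ (Fin 3))) = ssCylinder :=
    preimage_image_eq _ (injective_stAffine hβpos.ne' hRpos.ne' T x₀)
  have hL3 : ∫⁻ z in parCyl 0 1, ‖(α • stPull β R T x₀ u) z.1 z.2‖ₑ ^ (3 : ℕ) < ∞ := by
    rw [← ssCylinder_eq_parCyl, ← hpre, setLIntegral_enorm_pow_stRescale hβpos hRpos T x₀ α u _ 3]
    refine ENNReal.mul_lt_top (ENNReal.mul_lt_top (ENNReal.pow_lt_top enorm_lt_top)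
      ENNReal.ofReal_lt_top) ?_
    exact lt_of_le_of_lt (lintegral_mono_set hPcyl)
      (H.lintegral_cylinder_enorm_pow_three_lt_top hρT x₀)
  -- `π ∈ L^{3/2}(Q)`
  have hL32 : ∫⁻ z in parCyl 0 1, ‖(α ^ 2 • stPull β R T x₀ q) z.1 z.2‖ₑ ^ (3 / 2 : ℝ) < ∞ := by
    rw [← ssCylinder_eq_parCyl, ← hpre,
      setLIntegral_enorm_rpow_stRescale hβpos hRpos T x₀ (α ^ 2) q _ (by norm_num)]
    refine ENNReal.mul_lt_top (ENNReal.mul_lt_top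
      (ENNReal.rpow_lt_top_of_nonneg (by norm_num) enorm_ne_top) ENNReal.ofReal_lt_top) ?_
    exact lt_of_le_of_lt (lintegral_mono_set hPcyl)
      (H.lintegral_cylinder_gauged_pressure_lt_top hqae hρT x₀)
  -- rescaled times lie in `[0, T)`
  have htime : ∀ s : ℝ, s ∈ Ioo (-1 : ℝ) 0 → T + β * s ∈ Ico 0 T := by
    intro s hs
    constructor
    · nlinarith [hs.1]
    · nlinarith [hs.2]
  -- axisymmetry of the rescaled slices (`x₀` is fixed by the rotations, which are linear)
  have haxi : ∀ s ∈ Ioo (-1 : ℝ) 0, IsAxisymmetric ((α • stPull β R T x₀ u) s) := by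
    intro s hs θ y
    simp only [smul_stPull_apply]
    rw [show x₀ + R • rotZ θ y = rotZ θ (x₀ + R • y) by
      rw [SereginSverak2009.rotZ_add_vec, SereginSverak2009.rotZ_smul_vec,
        rotZ_eq_self_of_cylRadius_eq_zero θ hx₀],
      H.axisymmetric _ (htime s hs) θ, SereginSverak2009.rotZ_smul_vec]
  have hloc : IsAxisymmetricLocalSolution (α • stPull β R T x₀ u) (α ^ 2 • stPull β R T x₀ q) :=
    ⟨hdist, hL3, hL32, haxi⟩
  -- (r2) for the rescaled field, from the sub-slab bounds of `u`
  have hr2 : IsBoundedAwayFromZero (α • stPull β R T x₀ u) := by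
    intro a ha
    have hβa : 0 < β * a ^ 2 := mul_pos hβpos (pow_pos ha.1 2)
    obtain ⟨M, hM⟩ := H.bounded_subslab (T - β * a ^ 2) (by linarith)
    refine ⟨α * M, (ae_restrict_mem (isOpen_parCyl 0 1).measurableSet).mono ?_⟩
    intro z hz hza
    obtain ⟨hs, -, -⟩ := mem_parCyl_zero.1 hz
    have ht : T + β * z.1 ∈ Icc 0 (T - β * a ^ 2) := by
      constructor
      · have := (htime z.1 (by simpa using hs)).1
        exact this
      · nlinarith [hza]
    rw [smul_stPull_apply, norm_smul, Real.norm_of_nonneg hαpos.le]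
    exact mul_le_mul_of_nonneg_left (hM _ ht _) hαpos.le
  -- (1.1) for the rescaled field, from the LOCAL poloidal rate of `u`: the zoom maps `Q` into
  -- `Q((T, x₀), ρ) ⊆ ]T - δ², T[ × B(x₀, δ)`
  have hmerv : IsMeridionalTypeIOnCyl (α • stPull β R T x₀ u) := by
    refine ⟨α / Real.sqrt β * C, (ae_restrict_mem (isOpen_parCyl 0 1).measurableSet).mono ?_⟩
    intro z hz
    obtain ⟨hs, -, -⟩ := mem_parCyl_zero.1 hz
    have hs' : z.1 ∈ Ioo (-1 : ℝ) 0 := by simpa using hs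
    have hτ := htime z.1 hs'
    have hzss : z ∈ ssCylinder := by rw [ssCylinder_eq_parCyl]; exact hz
    have hP : stAffine β R T x₀ z ∈ parabolicCylinder ρ ((T : ℝ), x₀) := hPcyl ⟨z, hzss, rfl⟩
    rw [mem_parabolicCylinder, stAffine_apply] at hP
    obtain ⟨⟨hP1, -⟩, hP3⟩ := hP
    dsimp only at hP1 hP3
    have hρδ2 : ρ ^ 2 ≤ δ ^ 2 := pow_le_pow_left₀ (by positivity) hρδ 2
    have hrate := hmer _ hτ (by linarith) (x₀ + R • z.2) (mem_ball.2 (hP3.trans_le hρδ))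
    have hsq : Real.sqrt (T - (T + β * z.1)) = Real.sqrt β * Real.sqrt (-z.1) := by
      rw [show T - (T + β * z.1) = β * (-z.1) by ring, Real.sqrt_mul hβpos.le]
    rw [hsq] at hrate
    have hsβ : 0 < Real.sqrt β := Real.sqrt_pos.2 hβpos
    have hpol : poloidalPart ((α • stPull β R T x₀ u) z.1) z.2 =
        α • poloidalPart (u (T + β * z.1)) (x₀ + R • z.2) := by
      have hfun : (α • stPull β R T x₀ u) z.1 = fun y' => α • u (T + β * z.1) (x₀ + R • y') := by
        funext y'; rfl
      rw [hfun, poloidalPart_axis_zoom hx₀ hRpos]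
    rw [hpol, norm_smul, Real.norm_of_nonneg hαpos.le]
    calc Real.sqrt (-z.1) * (α * ‖poloidalPart (u (T + β * z.1)) (x₀ + R • z.2)‖)
        = α / Real.sqrt β *
            (Real.sqrt β * Real.sqrt (-z.1) * ‖poloidalPart (u (T + β * z.1)) (x₀ + R • z.2)‖) := by
          field_simp
      _ ≤ α / Real.sqrt β * C := mul_le_mul_of_nonneg_left hrate (by positivity)
  -- (as7) for the rescaled field, from the swirl bound of `u` (`Γ` is zoom invariant up to `α/R`)
  obtain ⟨M, hM⟩ := hΓ
  have hswv : ∃ C₂ : ℝ, ∀ᵐ z ∂(volume.restrict (parCyl 0 1)),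
      |swirl ((α • stPull β R T x₀ u) z.1) z.2| ≤ C₂ := by
    refine ⟨α / R * M, (ae_restrict_mem (isOpen_parCyl 0 1).measurableSet).mono ?_⟩
    intro z hz
    obtain ⟨hs, -, -⟩ := mem_parCyl_zero.1 hz
    have hs' : z.1 ∈ Ioo (-1 : ℝ) 0 := by simpa using hs
    have hτ := htime z.1 hs'
    have hbd := hM _ hτ (x₀ + R • z.2)
    have hfun : (α • stPull β R T x₀ u) z.1 = fun y' => α • u (T + β * z.1) (x₀ + R • y') := by
      funext y'; rfl
    have hid : swirl ((α • stPull β R T x₀ u) z.1) z.2 =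
        α / R * swirl (u (T + β * z.1)) (x₀ + R • z.2) := by
      have h1 := swirl_axis_zoom hx₀ α R (u (T + β * z.1)) z.2
      have hR0 : R ≠ 0 := hRpos.ne'
      rw [hfun]
      field_simp
      linear_combination h1
    rw [hid, abs_mul, abs_of_pos (div_pos hαpos hRpos)]
    exact mul_le_mul_of_nonneg_left hbd (div_pos hαpos hRpos).le
  -- the theorem: regularity of the origin for the rescaled field, transported back
  obtain ⟨r, hr, hbd⟩ := exists_eLpNorm_parabolicCylinder_lt_top_of_isRegularAtOrigin
    (isRegularAtOrigin_of_meridionalTypeI_of_swirlBound hloc hr2 hmerv hswv)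
  exact H.isBoundedNearTop_of_eLpNorm_rescaled_lt_top x₀ hαpos hβpos hRpos hr hbd

/-- **Local kill form at an axis point — classical, unconditional for bounded swirl**: if
`(T, x₀)`, `x₀` on the axis, is NOT a regular point of a solution in the class
`AxisymmetricL3Hyp ν T u p` with `|Γ| ≤ M` on `[0, T) × ℝ³`, then `√(T - t)‖ū(t, x)‖` is unbounded
in every parabolic neighbourhood `]T - δ², T[ × B(x₀, δ)` of `(T, x₀)`: for all `δ > 0` and `C`
there are `t ∈ [0, T)`, `t > T - δ²`, and `x ∈ B(x₀, δ)` with `√(T - t)‖ū(t, x)‖ > C`.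
[cite: SereginSverak2009, Thm 1.1 (arXiv p. 3) with (1.1) (p. 2)] -/
theorem SereginSverak2009.exists_sqrt_mul_norm_poloidal_gt_near_axis_of_not_isBoundedNearTop
    (H : AxisymmetricL3Hyp ν T u p) (x₀ : EuclideanSpace ℝ (Fin 3)) (hx₀ : cylRadius x₀ = 0)
    (hΓ : ∃ M : ℝ, ∀ t ∈ Ico 0 T, ∀ x, |swirl (u t) x| ≤ M) (hsing : ¬ IsBoundedNearTop u T x₀)
    {δ : ℝ} (hδ : 0 < δ) (C : ℝ) :
    ∃ t ∈ Ico 0 T, T - δ ^ 2 < t ∧ ∃ x ∈ ball x₀ δ,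
      C < Real.sqrt (T - t) * ‖poloidalPart (u t) x‖ := by
  by_contra hcon
  push Not at hcon
  exact hsing (isBoundedNearTop_axis_of_localMeridionalTypeI_of_swirlBound H x₀ hx₀ hδ
    (fun t ht htδ x hx => hcon t ht htδ x hx) hΓ)

/-- **Axis points are regular under the meridional Type I rate on `[0, T) × ℝ³` and a swirl
bound — classical, unconditional** (the global-rate special case, `δ = 1`).
[cite: SereginSverak2009, Thm 1.1 (arXiv p. 3) with (1.1) (p. 2), Lemma 3.3 (as1) (p. 9)] -/
theorem SereginSverak2009.isBoundedNearTop_axis_of_meridionalTypeI_of_swirlBound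
    (H : AxisymmetricL3Hyp ν T u p)
    (hmer : ∃ C : ℝ, ∀ t ∈ Ico 0 T, ∀ x, Real.sqrt (T - t) * ‖poloidalPart (u t) x‖ ≤ C)
    (hΓ : ∃ M : ℝ, ∀ t ∈ Ico 0 T, ∀ x, |swirl (u t) x| ≤ M)
    (x₀ : EuclideanSpace ℝ (Fin 3)) (hx₀ : cylRadius x₀ = 0) : IsBoundedNearTop u T x₀ := by
  obtain ⟨C, hC⟩ := hmer
  exact isBoundedNearTop_axis_of_localMeridionalTypeI_of_swirlBound H x₀ hx₀ one_pos
    (fun t ht _ x _ => hC t ht x) hΓ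

/-- **The same from a bound on the swirl of the DATUM** `|Γ₀| ≤ M`: the maximum principle for
`Γ` on `[0, T)` (`abs_swirl_le_of_classical_Ico`, KNSS 2009 (1.9)) gives `|Γ(t,x)| ≤ M` there.
[cite: SereginSverak2009, Thm 1.1 (arXiv p. 3) with (1.1) (p. 2); KochNadirashviliSereginSverak2009, (1.9)] -/
theorem SereginSverak2009.isBoundedNearTop_axis_of_meridionalTypeI_of_swirl₀
    (H : AxisymmetricL3Hyp ν T u p)
    (hmer : ∃ C : ℝ, ∀ t ∈ Ico 0 T, ∀ x, Real.sqrt (T - t) * ‖poloidalPart (u t) x‖ ≤ C)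
    (hΓ₀ : ∃ M : ℝ, ∀ x, |swirl (u 0) x| ≤ M)
    (x₀ : EuclideanSpace ℝ (Fin 3)) (hx₀ : cylRadius x₀ = 0) : IsBoundedNearTop u T x₀ := by
  obtain ⟨M, hM⟩ := hΓ₀
  exact isBoundedNearTop_axis_of_meridionalTypeI_of_swirlBound H hmer
    ⟨M, abs_swirl_le_of_classical_Ico H.viscosity_pos H.classical H.axisymmetric
      H.bounded_subslab hM⟩ x₀ hx₀

/-- **Local kill form at an axis point from the datum**: `|Γ₀| ≤ M` (e.g. a rapidly decaying
datum) and `(T, x₀)` singular ⇒ `√(T - t)‖ū‖` unbounded near `(T, x₀)`.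
[cite: SereginSverak2009, Thm 1.1 (arXiv p. 3) with (1.1) (p. 2); KochNadirashviliSereginSverak2009, (1.9)] -/
theorem SereginSverak2009.exists_sqrt_mul_norm_poloidal_gt_near_axis_of_swirl₀
    (H : AxisymmetricL3Hyp ν T u p) (x₀ : EuclideanSpace ℝ (Fin 3)) (hx₀ : cylRadius x₀ = 0)
    (hΓ₀ : ∃ M : ℝ, ∀ x, |swirl (u 0) x| ≤ M) (hsing : ¬ IsBoundedNearTop u T x₀)
    {δ : ℝ} (hδ : 0 < δ) (C : ℝ) :
    ∃ t ∈ Ico 0 T, T - δ ^ 2 < t ∧ ∃ x ∈ ball x₀ δ,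
      C < Real.sqrt (T - t) * ‖poloidalPart (u t) x‖ := by
  obtain ⟨M, hM⟩ := hΓ₀
  exact exists_sqrt_mul_norm_poloidal_gt_near_axis_of_not_isBoundedNearTop H x₀ hx₀
    ⟨M, abs_swirl_le_of_classical_Ico H.viscosity_pos H.classical H.axisymmetric
      H.bounded_subslab hM⟩ hsing hδ C

/-- **Boundedness up to the final time under the meridional Type I rate — unconditional for
`Γ₀ ∈ L^∞`**: with the axis input above, the tree's Type-I-free off-axis input
(`axisymmetricL3_boundedNearTop_offAxis`, CKN) and spatial-infinity input
(`axisymmetricL3_boundedNearTop_infinity`) and the compactness glue (`exists_bound_final_slab`,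
`exists_bound_Ico_of_final_slab`), `u` is bounded on `[0, T) × ℝ³`.
[cite: SereginSverak2009, Thm 1.1 (arXiv p. 3); KochNadirashviliSereginSverak2009, Thm 6.2 and (1.9)] -/
theorem SereginSverak2009.exists_bound_Ico_of_meridionalTypeI (H : AxisymmetricL3Hyp ν T u p)
    (hmer : ∃ C : ℝ, ∀ t ∈ Ico 0 T, ∀ x, Real.sqrt (T - t) * ‖poloidalPart (u t) x‖ ≤ C)
    (hΓ₀ : ∃ M : ℝ, ∀ x, |swirl (u 0) x| ≤ M) :
    ∃ M : ℝ, ∀ t ∈ Ico 0 T, ∀ x, ‖u t x‖ ≤ M := by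
  have hloc : ∀ x₀ : EuclideanSpace ℝ (Fin 3), IsBoundedNearTop u T x₀ := fun x₀ => by
    by_cases h0 : cylRadius x₀ = 0
    · exact isBoundedNearTop_axis_of_meridionalTypeI_of_swirl₀ H hmer hΓ₀ x₀ h0
    · exact axisymmetricL3_boundedNearTop_offAxis H x₀ h0
  obtain ⟨R, r₁, K₁, hr₁, hfar⟩ := axisymmetricL3_boundedNearTop_infinity H
  obtain ⟨r₀, hr₀, K, hK⟩ := exists_bound_final_slab hloc hr₁ hfar
  exact exists_bound_Ico_of_final_slab H.bounded_subslab hr₀ hK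

/-- **No blow-up under a Type I rate on the poloidal velocity alone, for data with bounded
swirl — unconditional** (Seregin–Šverák 2009, Thm. 1.1 read globally; cf. KNSS 2009, Thm. 6.2
with the rate on the full velocity, `knss_no_axisymmetric_typeI_holds`). Let `ν > 0`, `T > 0`,
`(u, p)` a classical Navier–Stokes solution (`f = 0`) on `ℝ³ × [0, T)`, Leray–Hopf on `[0, T)`
from `u 0`, bounded on `ℝ³ × [0, T']` for every `T' < T`, with axisymmetric slices and
`Γ₀ = ϱ u₀^θ ∈ L^∞`, and suppose only the POLOIDAL part obeys the Type I rate,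
`√(T - t) ‖ū(t, x)‖ ≤ C` for `0 ≤ t < T`. Then `u` extends as a classical solution past `T`
(`exists_bound_Ico_of_meridionalTypeI` and `hasSmoothExtensionPast_of_bounded_holds`).
[cite: SereginSverak2009, Thm 1.1 (arXiv p. 3) with (1.1) (p. 2); KochNadirashviliSereginSverak2009, (1.9)] -/
theorem SereginSverak2009.hasSmoothExtensionPast_of_meridionalTypeI (hν : 0 < ν) (hT : 0 < T)
    (h : IsClassicalNSSolutionOn (Ico 0 T) ν 0 u p) (hLH : IsLerayHopfOn T ν 0 (u 0) u)
    (hbdd : ∀ T' < T, ∃ M : ℝ, ∀ t ∈ Icc 0 T', ∀ x, ‖u t x‖ ≤ M)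
    (haxi : ∀ t ∈ Ico 0 T, IsAxisymmetric (u t)) (hΓ₀ : ∃ M : ℝ, ∀ x, |swirl (u 0) x| ≤ M)
    (hmer : ∃ C : ℝ, ∀ t ∈ Ico 0 T, ∀ x, Real.sqrt (T - t) * ‖poloidalPart (u t) x‖ ≤ C) :
    HasSmoothExtensionPast ν 0 u T :=
  hasSmoothExtensionPast_of_bounded_holds hν hT h hLH
    (exists_bound_Ico_of_meridionalTypeI ⟨hν, hT, h, hLH, hbdd, haxi⟩ hmer hΓ₀)

/-- **The same for a rapidly decaying datum** (`Γ₀ ∈ L^∞` by `HasRapidSpatialDecay.abs_swirl_le`).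
[cite: SereginSverak2009, Thm 1.1 (arXiv p. 3) with (1.1) (p. 2)] -/
theorem SereginSverak2009.hasSmoothExtensionPast_of_meridionalTypeI_of_rapidDecay (hν : 0 < ν)
    (hT : 0 < T) (h : IsClassicalNSSolutionOn (Ico 0 T) ν 0 u p)
    (hLH : IsLerayHopfOn T ν 0 (u 0) u)
    (hbdd : ∀ T' < T, ∃ M : ℝ, ∀ t ∈ Icc 0 T', ∀ x, ‖u t x‖ ≤ M)
    (haxi : ∀ t ∈ Ico 0 T, IsAxisymmetric (u t)) (hdecay : HasRapidSpatialDecay (u 0))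
    (hmer : ∃ C : ℝ, ∀ t ∈ Ico 0 T, ∀ x, Real.sqrt (T - t) * ‖poloidalPart (u t) x‖ ≤ C) :
    HasSmoothExtensionPast ν 0 u T :=
  hasSmoothExtensionPast_of_meridionalTypeI hν hT h hLH hbdd haxi hdecay.abs_swirl_le hmer

/-- **The same with the rate in the tree's `IsTypeIBlowup` spelling, applied to the poloidal
field** `(t, x) ↦ ū(t, x)`: `∃ C, ∀ᶠ t → T⁻, ∀ x, ‖ū(t,x)‖ ≤ C/√(T - t)`; on `[0, T₁]` the poloidal
part is bounded with `u` (`‖ū‖ ≤ ‖u‖`), so the rate holds on all of `[0, T)`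
(`IsTypeIBlowup.exists_sqrt_mul_norm_le`). Unconditional for `Γ₀ ∈ L^∞`.
[cite: SereginSverak2009, Thm 1.1 (arXiv p. 3) with (1.1) (p. 2); KochNadirashviliSereginSverak2009, (1.9)] -/
theorem SereginSverak2009.hasSmoothExtensionPast_of_isTypeIBlowup_poloidal (hν : 0 < ν)
    (hT : 0 < T) (h : IsClassicalNSSolutionOn (Ico 0 T) ν 0 u p)
    (hLH : IsLerayHopfOn T ν 0 (u 0) u)
    (hbdd : ∀ T' < T, ∃ M : ℝ, ∀ t ∈ Icc 0 T', ∀ x, ‖u t x‖ ≤ M)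
    (haxi : ∀ t ∈ Ico 0 T, IsAxisymmetric (u t)) (hΓ₀ : ∃ M : ℝ, ∀ x, |swirl (u 0) x| ≤ M)
    (hI : IsTypeIBlowup (fun t x => poloidalPart (u t) x) T) :
    HasSmoothExtensionPast ν 0 u T := by
  have hbdd' : ∀ T' < T, ∃ M : ℝ, ∀ t ∈ Icc 0 T', ∀ x,
      ‖(fun t x => poloidalPart (u t) x) t x‖ ≤ M := by
    intro T' hT'
    obtain ⟨M, hM⟩ := hbdd T' hT'
    exact ⟨M, fun t ht x => (norm_poloidalPart_le (u t) x).trans (hM t ht x)⟩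
  exact hasSmoothExtensionPast_of_meridionalTypeI hν hT h hLH hbdd haxi hΓ₀
    (hI.exists_sqrt_mul_norm_le hbdd')

/-- **Kill form — unconditional for `Γ₀ ∈ L^∞`**: at a genuine lifespan `T`
(`IsMaximalSmoothSolution`) of a classical axisymmetric Leray–Hopf solution bounded on sub-slabs
with `|Γ₀| ≤ M`, the weighted poloidal velocity `√(T - t) ‖ū(t, x)‖` is unbounded on
`[0, T) × ℝ³`. This is the statement against which an axisymmetric numerical blow-up candidate
printing `√(T_fit - t)·‖u_pol‖_∞` is read.
[cite: SereginSverak2009, Thm 1.1 (arXiv p. 3) with (1.1) (p. 2); KochNadirashviliSereginSverak2009, (1.9)] -/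
theorem SereginSverak2009.exists_sqrt_mul_norm_poloidal_gt_of_isMaximalSmoothSolution
    (hν : 0 < ν) (hT : 0 < T) (hmax : IsMaximalSmoothSolution ν 0 u p T)
    (hLH : IsLerayHopfOn T ν 0 (u 0) u)
    (hbdd : ∀ T' < T, ∃ M : ℝ, ∀ t ∈ Icc 0 T', ∀ x, ‖u t x‖ ≤ M)
    (haxi : ∀ t ∈ Ico 0 T, IsAxisymmetric (u t)) (hΓ₀ : ∃ M : ℝ, ∀ x, |swirl (u 0) x| ≤ M)
    (C : ℝ) : ∃ t ∈ Ico 0 T, ∃ x, C < Real.sqrt (T - t) * ‖poloidalPart (u t) x‖ := by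
  by_contra hcon
  push Not at hcon
  exact hmax.2 (hasSmoothExtensionPast_of_meridionalTypeI hν hT hmax.1 hLH hbdd haxi hΓ₀
    ⟨C, hcon⟩)

/-- **Kill form for a rapidly decaying datum.** [cite: SereginSverak2009, Thm 1.1 (arXiv p. 3) with (1.1) (p. 2)] -/
theorem SereginSverak2009.exists_sqrt_mul_norm_poloidal_gt_of_isMaximalSmoothSolution_of_rapidDecay
    (hν : 0 < ν) (hT : 0 < T) (hmax : IsMaximalSmoothSolution ν 0 u p T)
    (hLH : IsLerayHopfOn T ν 0 (u 0) u)
    (hbdd : ∀ T' < T, ∃ M : ℝ, ∀ t ∈ Icc 0 T', ∀ x, ‖u t x‖ ≤ M)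
    (haxi : ∀ t ∈ Ico 0 T, IsAxisymmetric (u t)) (hdecay : HasRapidSpatialDecay (u 0))
    (C : ℝ) : ∃ t ∈ Ico 0 T, ∃ x, C < Real.sqrt (T - t) * ‖poloidalPart (u t) x‖ :=
  exists_sqrt_mul_norm_poloidal_gt_of_isMaximalSmoothSolution hν hT hmax hLH hbdd haxi
    hdecay.abs_swirl_le C

/-! ### The sharpest classical reading: a singular time needs a meridional-Type-II axis point -/

/-- **Boundedness up to `T` from LOCAL meridional rates at every axis point** (`Γ₀ ∈ L^∞`): if
every axis point `(T, x₀)` has a parabolic neighbourhood on which `√(T - t)‖ū‖` is bounded, then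
`u` is bounded on `[0, T) × ℝ³` (axis points by
`isBoundedNearTop_axis_of_localMeridionalTypeI_of_swirlBound`, off-axis points and spatial
infinity by the Type-I-free inputs of `AxisymmetricL3OffTube`).
[cite: SereginSverak2009, Thm 1.1 (arXiv p. 3) with (1.1) (p. 2); KochNadirashviliSereginSverak2009, (1.9)] -/
theorem SereginSverak2009.exists_bound_Ico_of_localMeridionalTypeI (H : AxisymmetricL3Hyp ν T u p)
    (hmer : ∀ x₀ : EuclideanSpace ℝ (Fin 3), cylRadius x₀ = 0 → ∃ δ > 0, ∃ C : ℝ,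
      ∀ t ∈ Ico 0 T, T - δ ^ 2 < t → ∀ x ∈ ball x₀ δ,
        Real.sqrt (T - t) * ‖poloidalPart (u t) x‖ ≤ C)
    (hΓ₀ : ∃ M : ℝ, ∀ x, |swirl (u 0) x| ≤ M) :
    ∃ M : ℝ, ∀ t ∈ Ico 0 T, ∀ x, ‖u t x‖ ≤ M := by
  obtain ⟨M, hM⟩ := hΓ₀
  have hΓ : ∃ M : ℝ, ∀ t ∈ Ico 0 T, ∀ x, |swirl (u t) x| ≤ M :=
    ⟨M, abs_swirl_le_of_classical_Ico H.viscosity_pos H.classical H.axisymmetric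
      H.bounded_subslab hM⟩
  have hloc : ∀ x₀ : EuclideanSpace ℝ (Fin 3), IsBoundedNearTop u T x₀ := fun x₀ => by
    by_cases h0 : cylRadius x₀ = 0
    · obtain ⟨δ, hδ, C, hC⟩ := hmer x₀ h0
      exact isBoundedNearTop_axis_of_localMeridionalTypeI_of_swirlBound H x₀ h0 hδ hC hΓ
    · exact axisymmetricL3_boundedNearTop_offAxis H x₀ h0
  obtain ⟨R, r₁, K₁, hr₁, hfar⟩ := axisymmetricL3_boundedNearTop_infinity H
  obtain ⟨r₀, hr₀, K, hK⟩ := exists_bound_final_slab hloc hr₁ hfar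
  exact exists_bound_Ico_of_final_slab H.bounded_subslab hr₀ hK

/-- **No blow-up from local meridional rates at the axis** (`Γ₀ ∈ L^∞`): a classical axisymmetric
Leray–Hopf solution on `[0, T)`, bounded on sub-slabs, with `|Γ₀| ≤ M`, every axis point of
which has a parabolic neighbourhood with `√(T - t)‖ū‖` bounded, extends smoothly past `T`.
[cite: SereginSverak2009, Thm 1.1 (arXiv p. 3) with (1.1) (p. 2); KochNadirashviliSereginSverak2009, (1.9)] -/
theorem SereginSverak2009.hasSmoothExtensionPast_of_localMeridionalTypeI (hν : 0 < ν) (hT : 0 < T)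
    (h : IsClassicalNSSolutionOn (Ico 0 T) ν 0 u p) (hLH : IsLerayHopfOn T ν 0 (u 0) u)
    (hbdd : ∀ T' < T, ∃ M : ℝ, ∀ t ∈ Icc 0 T', ∀ x, ‖u t x‖ ≤ M)
    (haxi : ∀ t ∈ Ico 0 T, IsAxisymmetric (u t)) (hΓ₀ : ∃ M : ℝ, ∀ x, |swirl (u 0) x| ≤ M)
    (hmer : ∀ x₀ : EuclideanSpace ℝ (Fin 3), cylRadius x₀ = 0 → ∃ δ > 0, ∃ C : ℝ,
      ∀ t ∈ Ico 0 T, T - δ ^ 2 < t → ∀ x ∈ ball x₀ δ,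
        Real.sqrt (T - t) * ‖poloidalPart (u t) x‖ ≤ C) :
    HasSmoothExtensionPast ν 0 u T :=
  hasSmoothExtensionPast_of_bounded_holds hν hT h hLH
    (exists_bound_Ico_of_localMeridionalTypeI ⟨hν, hT, h, hLH, hbdd, haxi⟩ hmer hΓ₀)

/-- **Kill form, sharpest classical reading**: at a genuine lifespan `T` (`IsMaximalSmoothSolution`)
of a classical axisymmetric Leray–Hopf solution bounded on sub-slabs with `|Γ₀| ≤ M`, there is an
AXIS POINT `x₀` at which the meridional velocity is Type II in every parabolic neighbourhood:
for all `δ > 0` and `C` some `(t, x) ∈ (]T - δ², T[ ∩ [0, T)) × B(x₀, δ)` has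
`√(T - t)‖ū(t, x)‖ > C`. This is the statement an axisymmetric numerical blow-up candidate must
exhibit: the point, and the divergence of `√(T_fit - t)·sup_{B(x₀,δ)}|u_pol|` for every `δ`.
[cite: SereginSverak2009, Thm 1.1 (arXiv p. 3) with (1.1) (p. 2); KochNadirashviliSereginSverak2009, (1.9)] -/
theorem SereginSverak2009.exists_axisPoint_meridionalTypeII_of_isMaximalSmoothSolution
    (hν : 0 < ν) (hT : 0 < T) (hmax : IsMaximalSmoothSolution ν 0 u p T)
    (hLH : IsLerayHopfOn T ν 0 (u 0) u)
    (hbdd : ∀ T' < T, ∃ M : ℝ, ∀ t ∈ Icc 0 T', ∀ x, ‖u t x‖ ≤ M)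
    (haxi : ∀ t ∈ Ico 0 T, IsAxisymmetric (u t)) (hΓ₀ : ∃ M : ℝ, ∀ x, |swirl (u 0) x| ≤ M) :
    ∃ x₀ : EuclideanSpace ℝ (Fin 3), cylRadius x₀ = 0 ∧ ∀ δ > 0, ∀ C : ℝ,
      ∃ t ∈ Ico 0 T, T - δ ^ 2 < t ∧ ∃ x ∈ ball x₀ δ,
        C < Real.sqrt (T - t) * ‖poloidalPart (u t) x‖ := by
  by_contra hcon
  push Not at hcon
  refine hmax.2 (hasSmoothExtensionPast_of_localMeridionalTypeI hν hT hmax.1 hLH hbdd haxi hΓ₀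
    fun x₀ hx₀ => ?_)
  obtain ⟨δ, hδ, C, hC⟩ := hcon x₀ hx₀
  exact ⟨δ, hδ, C, fun t ht htδ x hx => hC t ht htδ x hx⟩

/-- **The same for a rapidly decaying datum.** [cite: SereginSverak2009, Thm 1.1 (arXiv p. 3) with (1.1) (p. 2)] -/
theorem SereginSverak2009.exists_axisPoint_meridionalTypeII_of_isMaximalSmoothSolution_of_rapidDecay
    (hν : 0 < ν) (hT : 0 < T) (hmax : IsMaximalSmoothSolution ν 0 u p T)
    (hLH : IsLerayHopfOn T ν 0 (u 0) u)
    (hbdd : ∀ T' < T, ∃ M : ℝ, ∀ t ∈ Icc 0 T', ∀ x, ‖u t x‖ ≤ M)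
    (haxi : ∀ t ∈ Ico 0 T, IsAxisymmetric (u t)) (hdecay : HasRapidSpatialDecay (u 0)) :
    ∃ x₀ : EuclideanSpace ℝ (Fin 3), cylRadius x₀ = 0 ∧ ∀ δ > 0, ∀ C : ℝ,
      ∃ t ∈ Ico 0 T, T - δ ^ 2 < t ∧ ∃ x ∈ ball x₀ δ,
        C < Real.sqrt (T - t) * ‖poloidalPart (u t) x‖ :=
  exists_axisPoint_meridionalTypeII_of_isMaximalSmoothSolution hν hT hmax hLH hbdd haxi
    hdecay.abs_swirl_le

/-! ### The zoom about an axis point as a tool, and Theorem 1.2 localised (classical) -/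

/-- **The blow-up zoom about an axis point, abstract form** (Seregin–Šverák 2009, §3 p. 9 "The
general case is obtained by re-scaling", §4 p. 11): under `AxisymmetricL3Hyp ν T u p`, for `x₀` on
the axis and `δ > 0`, there are `α, β, R > 0` such that the viscosity-normalising zoom
`v(s, y) = α u(T + βs, x₀ + Ry)` with the gauged pressure `α² q ∘ Φ` satisfies the standing
assumptions of §3 with axial symmetry on `Q` (`IsAxisymmetricLocalSolution`) and (r2), and `Φ` maps
`Q` into `([0, T) ∩ ]T - δ², T[) × B(x₀, δ)`; hence ANY local regularity criterion at the origin
for such `v` (the argument `hreg`) yields boundedness of `u` near `(T, x₀)`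
(`AxisymmetricL3Hyp.isBoundedNearTop_of_eLpNorm_rescaled_lt_top`). The construction is that of
`isBoundedNearTop_axis_of_localMeridionalTypeI_of_swirlBound` (gauged pressure, cylinder of
size `min(√T, δ)/2`, `L³`/`L^{3/2}` classes, axisymmetry, (r2) from the sub-slab bounds).
[cite: SereginSverak2009, §3 p. 9 (re-scaling to the canonical domain) and §4 p. 11] -/
theorem AxisymmetricL3Hyp.isBoundedNearTop_axis_of_zoom (H : AxisymmetricL3Hyp ν T u p)
    (x₀ : EuclideanSpace ℝ (Fin 3)) (hx₀ : cylRadius x₀ = 0) {δ : ℝ} (hδ : 0 < δ)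
    (hreg : ∀ (α β R : ℝ) (q : ℝ → EuclideanSpace ℝ (Fin 3) → ℝ), 0 < α → 0 < β → 0 < R →
      IsAxisymmetricLocalSolution (α • stPull β R T x₀ u) (α ^ 2 • stPull β R T x₀ q) →
      IsBoundedAwayFromZero (α • stPull β R T x₀ u) →
      (∀ z ∈ parCyl (0 : ℝ × EuclideanSpace ℝ (Fin 3)) 1,
        T + β * z.1 ∈ Ico 0 T ∧ T - δ ^ 2 < T + β * z.1 ∧ x₀ + R • z.2 ∈ ball x₀ δ) →
      IsRegularAtOrigin (α • stPull β R T x₀ u)) :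
    IsBoundedNearTop u T x₀ := by
  have hν := H.viscosity_pos
  have hT := H.time_pos
  -- scales: `R > 0` with `ρ = R (2 + 1/√ν) = min(√T, δ) / 2`
  set κ : ℝ := 2 + (Real.sqrt ν)⁻¹ with hκ
  have hκpos : 0 < κ := by positivity
  set L : ℝ := min (Real.sqrt T) δ with hL
  have hLpos : 0 < L := lt_min (Real.sqrt_pos.2 hT) hδ
  have hLT : L ≤ Real.sqrt T := min_le_left _ _
  have hLδ : L ≤ δ := min_le_right _ _
  set R : ℝ := L / (2 * κ) with hR
  have hRpos : 0 < R := by positivity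
  set ρ : ℝ := R * κ with hρ
  have hρL : ρ = L / 2 := by rw [hρ, hR]; field_simp
  have hρT : ρ ^ 2 ≤ T := by
    rw [hρL, div_pow]
    have h1 : L ^ 2 ≤ T := by
      calc L ^ 2 ≤ Real.sqrt T ^ 2 := pow_le_pow_left₀ hLpos.le hLT 2
        _ = T := Real.sq_sqrt hT.le
    linarith
  have hρδ : ρ ≤ δ := by rw [hρL]; linarith
  set α : ℝ := R / ν with hα
  set β : ℝ := R ^ 2 / ν with hβdef
  have hαpos : 0 < α := by positivity
  have hβpos : 0 < β := by positivity
  have hβeq : β = α * R := by rw [hβdef, hα]; field_simp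
  have hβρ : β ≤ ρ ^ 2 := by
    have h1 : β = (R * (Real.sqrt ν)⁻¹) ^ 2 := by
      rw [hβdef, mul_pow, inv_pow, Real.sq_sqrt hν.le, div_eq_mul_inv]
    rw [h1, hρ]
    have h2 : (Real.sqrt ν)⁻¹ ≤ κ := by rw [hκ]; linarith
    exact pow_le_pow_left₀ (by positivity) (mul_le_mul_of_nonneg_left h2 hRpos.le) 2
  have hβT : β ≤ T := hβρ.trans hρT
  have h2Rρ : 2 * R ≤ ρ := by
    rw [hρ, hκ]
    have : 0 ≤ (Real.sqrt ν)⁻¹ := by positivity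
    nlinarith
  -- the gauged pressure and the physical cylinder
  obtain ⟨q, hsuit, hqae, -⟩ := H.exists_gauged_pressure
  have hPopen := isOpen_image_stAffine_ssCylinder (T := T) (x₀ := x₀) hβpos.ne' hRpos.ne'
  set PO : Opens (ℝ × EuclideanSpace ℝ (Fin 3)) := ⟨stAffine β R T x₀ '' ssCylinder, hPopen⟩
    with hPO
  have hPcyl : (PO : Set (ℝ × EuclideanSpace ℝ (Fin 3))) ⊆ parabolicCylinder ρ ((T : ℝ), x₀) :=
    image_stAffine_ssCylinder_subset hβpos hRpos hβρ h2Rρ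
  have hcylslab : parabolicCylinder ρ ((T : ℝ), x₀) ⊆
      Ioo 0 T ×ˢ (univ : Set (EuclideanSpace ℝ (Fin 3))) := by
    intro z hz
    rw [mem_parabolicCylinder] at hz
    exact ⟨⟨by nlinarith [hz.1.1], hz.1.2⟩, mem_univ _⟩
  have hPslab : (PO : Set (ℝ × EuclideanSpace ℝ (Fin 3))) ⊆
      Ioo 0 T ×ˢ (univ : Set (EuclideanSpace ℝ (Fin 3))) := hPcyl.trans hcylslab
  -- the rescaled pair solves the unit-viscosity system in distributions on the unit cylinder
  have hdist : IsDistributionalNSSolutionOn (parCylOpens 0 1) 1 0 (α • stPull β R T x₀ u)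
      (α ^ 2 • stPull β R T x₀ q) := by
    have h0 := ((hsuit PO hPslab).distributional).stRescale hαpos hRpos hβeq T x₀
    have hvisc : α * ν / R = 1 := by
      rw [hα, div_mul_cancel₀ R hν.ne', div_self hRpos.ne']
    have hforce : ((α ^ 2 * R) • stPull β R T x₀
        (0 : ℝ → EuclideanSpace ℝ (Fin 3) → EuclideanSpace ℝ (Fin 3))) = 0 := by
      funext s y; simp [stPull]
    rw [hvisc, hforce, stPreimage_image_ssCylinder hβpos.ne' hRpos.ne' hPopen,
      ssCylinderOpens_eq_parCylOpens] at h0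
    exact h0
  -- `v ∈ L³(Q)`
  have hpre : stAffine β R T x₀ ⁻¹' (PO : Set (ℝ × EuclideanSpace ℝ (Fin 3))) = ssCylinder :=
    preimage_image_eq _ (injective_stAffine hβpos.ne' hRpos.ne' T x₀)
  have hL3 : ∫⁻ z in parCyl 0 1, ‖(α • stPull β R T x₀ u) z.1 z.2‖ₑ ^ (3 : ℕ) < ∞ := by
    rw [← ssCylinder_eq_parCyl, ← hpre, setLIntegral_enorm_pow_stRescale hβpos hRpos T x₀ α u _ 3]
    refine ENNReal.mul_lt_top (ENNReal.mul_lt_top (ENNReal.pow_lt_top enorm_lt_top)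
      ENNReal.ofReal_lt_top) ?_
    exact lt_of_le_of_lt (lintegral_mono_set hPcyl)
      (H.lintegral_cylinder_enorm_pow_three_lt_top hρT x₀)
  -- `π ∈ L^{3/2}(Q)`
  have hL32 : ∫⁻ z in parCyl 0 1, ‖(α ^ 2 • stPull β R T x₀ q) z.1 z.2‖ₑ ^ (3 / 2 : ℝ) < ∞ := by
    rw [← ssCylinder_eq_parCyl, ← hpre,
      setLIntegral_enorm_rpow_stRescale hβpos hRpos T x₀ (α ^ 2) q _ (by norm_num)]
    refine ENNReal.mul_lt_top (ENNReal.mul_lt_top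
      (ENNReal.rpow_lt_top_of_nonneg (by norm_num) enorm_ne_top) ENNReal.ofReal_lt_top) ?_
    exact lt_of_le_of_lt (lintegral_mono_set hPcyl)
      (H.lintegral_cylinder_gauged_pressure_lt_top hqae hρT x₀)
  -- rescaled times lie in `[0, T)`
  have htime : ∀ s : ℝ, s ∈ Ioo (-1 : ℝ) 0 → T + β * s ∈ Ico 0 T := by
    intro s hs
    constructor
    · nlinarith [hs.1]
    · nlinarith [hs.2]
  -- axisymmetry of the rescaled slices (`x₀` is fixed by the rotations, which are linear)
  have haxi : ∀ s ∈ Ioo (-1 : ℝ) 0, IsAxisymmetric ((α • stPull β R T x₀ u) s) := by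
    intro s hs θ y
    simp only [smul_stPull_apply]
    rw [show x₀ + R • rotZ θ y = rotZ θ (x₀ + R • y) by
      rw [SereginSverak2009.rotZ_add_vec, SereginSverak2009.rotZ_smul_vec,
        rotZ_eq_self_of_cylRadius_eq_zero θ hx₀],
      H.axisymmetric _ (htime s hs) θ, SereginSverak2009.rotZ_smul_vec]
  have hloc : IsAxisymmetricLocalSolution (α • stPull β R T x₀ u) (α ^ 2 • stPull β R T x₀ q) :=
    ⟨hdist, hL3, hL32, haxi⟩
  -- (r2) for the rescaled field, from the sub-slab bounds of `u`
  have hr2 : IsBoundedAwayFromZero (α • stPull β R T x₀ u) := by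
    intro a ha
    have hβa : 0 < β * a ^ 2 := mul_pos hβpos (pow_pos ha.1 2)
    obtain ⟨M, hM⟩ := H.bounded_subslab (T - β * a ^ 2) (by linarith)
    refine ⟨α * M, (ae_restrict_mem (isOpen_parCyl 0 1).measurableSet).mono ?_⟩
    intro z hz hza
    obtain ⟨hs, -, -⟩ := mem_parCyl_zero.1 hz
    have ht : T + β * z.1 ∈ Icc 0 (T - β * a ^ 2) := by
      constructor
      · have := (htime z.1 (by simpa using hs)).1
        exact this
      · nlinarith [hza]
    rw [smul_stPull_apply, norm_smul, Real.norm_of_nonneg hαpos.le]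
    exact mul_le_mul_of_nonneg_left (hM _ ht _) hαpos.le
  -- `Φ` maps `Q` into `([0, T) ∩ ]T - δ², T[) × B(x₀, δ)`
  have hmaps : ∀ z ∈ parCyl (0 : ℝ × EuclideanSpace ℝ (Fin 3)) 1,
      T + β * z.1 ∈ Ico 0 T ∧ T - δ ^ 2 < T + β * z.1 ∧ x₀ + R • z.2 ∈ ball x₀ δ := by
    intro z hz
    obtain ⟨hs, -, -⟩ := mem_parCyl_zero.1 hz
    have hs' : z.1 ∈ Ioo (-1 : ℝ) 0 := by simpa using hs
    have hzss : z ∈ ssCylinder := by rw [ssCylinder_eq_parCyl]; exact hz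
    have hP : stAffine β R T x₀ z ∈ parabolicCylinder ρ ((T : ℝ), x₀) := hPcyl ⟨z, hzss, rfl⟩
    rw [mem_parabolicCylinder, stAffine_apply] at hP
    obtain ⟨⟨hP1, -⟩, hP3⟩ := hP
    dsimp only at hP1 hP3
    have hρδ2 : ρ ^ 2 ≤ δ ^ 2 := pow_le_pow_left₀ (by positivity) hρδ 2
    exact ⟨htime z.1 hs', by linarith, mem_ball.2 (hP3.trans_le hρδ)⟩
  -- the criterion: regularity of the origin for the rescaled field, transported back
  obtain ⟨r, hr, hbd⟩ := exists_eLpNorm_parabolicCylinder_lt_top_of_isRegularAtOrigin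
    (hreg α β R q hαpos hβpos hRpos hloc hr2 hmaps)
  exact H.isBoundedNearTop_of_eLpNorm_rescaled_lt_top x₀ hαpos hβpos hRpos hr hbd

/-- The swirl of the zoom about an axis point is bounded when the swirl is:
`|Γ[v(s)](y)| = (α/R)|Γ[u(T+βs)](x₀ + Ry)| ≤ (α/R) M` a.e. on `Q` (`swirl_axis_zoom`).
[cite: SereginSverak2009, §3 Lemma 3.3 (as7) (arXiv p. 9) and §4 p. 11] -/
theorem SereginSverak2009.ae_swirlBound_axis_zoom {x₀ : EuclideanSpace ℝ (Fin 3)}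
    (hx₀ : cylRadius x₀ = 0) {α β R M : ℝ} (hα : 0 < α) (hR : 0 < R)
    (hM : ∀ t ∈ Ico 0 T, ∀ x, |swirl (u t) x| ≤ M)
    (hmaps : ∀ z ∈ parCyl (0 : ℝ × EuclideanSpace ℝ (Fin 3)) 1, T + β * z.1 ∈ Ico 0 T) :
    ∀ᵐ z ∂(volume.restrict (parCyl 0 1)), |swirl ((α • stPull β R T x₀ u) z.1) z.2| ≤ α / R * M := by
  refine (ae_restrict_mem (isOpen_parCyl 0 1).measurableSet).mono fun z hz => ?_
  have hbd := hM _ (hmaps z hz) (x₀ + R • z.2)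
  have hfun : (α • stPull β R T x₀ u) z.1 = fun y' => α • u (T + β * z.1) (x₀ + R • y') := by
    funext y'; rfl
  have hid : swirl ((α • stPull β R T x₀ u) z.1) z.2 =
      α / R * swirl (u (T + β * z.1)) (x₀ + R • z.2) := by
    have h1 := swirl_axis_zoom hx₀ α R (u (T + β * z.1)) z.2
    have hR0 : R ≠ 0 := hR.ne'
    rw [hfun]
    field_simp
    linear_combination h1
  rw [hid, abs_mul, abs_of_pos (div_pos hα hR)]
  exact mul_le_mul_of_nonneg_left hbd (div_pos hα hR).le

/-- **Seregin–Šverák 2009, Theorem 1.2, LOCAL and classical — unconditional for bounded swirl**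
(the paper's hypothesis "`sup_{Q(z₀,R)} √(x₁²+x₂²)|v̄| < +∞` for some `R > 0`", p. 2): under
`AxisymmetricL3Hyp ν T u p`, `x₀` on the axis, `|x'| ‖ū(t, x)‖ ≤ C` on a parabolic
neighbourhood `]T - δ², T[ × B(x₀, δ)` of `(T, x₀)` and `|Γ| ≤ M` on `[0, T) × ℝ³`, the point
`(T, x₀)` is regular. Proof: the zoom tool `AxisymmetricL3Hyp.isBoundedNearTop_axis_of_zoom` fed
with the tree's local weak-class Thm 3.2-on-`v̄` (`isRegularAtOrigin_of_poloidalAxisDecay`; the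
bounds `|y'|‖v̄‖ ≤ (α/R)C`, `|Γ[v]| ≤ (α/R)M` are scale covariant, `cylRadius_axis_add_smul`,
`swirl_axis_zoom`). [cite: SereginSverak2009, Thm 1.2 (arXiv p. 3) with its hypothesis (p. 2), Thm 3.2, Lemma 3.3] -/
theorem SereginSverak2009.isBoundedNearTop_axis_of_localPoloidalAxisDecay_of_swirlBound
    (H : AxisymmetricL3Hyp ν T u p) (x₀ : EuclideanSpace ℝ (Fin 3)) (hx₀ : cylRadius x₀ = 0)
    {δ C : ℝ} (hδ : 0 < δ)
    (hpol : ∀ t ∈ Ico 0 T, T - δ ^ 2 < t → ∀ x ∈ ball x₀ δ,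
      cylRadius x * ‖poloidalPart (u t) x‖ ≤ C)
    (hΓ : ∃ M : ℝ, ∀ t ∈ Ico 0 T, ∀ x, |swirl (u t) x| ≤ M) : IsBoundedNearTop u T x₀ := by
  obtain ⟨M, hM⟩ := hΓ
  obtain ⟨h0, h1⟩ := (cylRadius_eq_zero_iff x₀).1 hx₀
  refine H.isBoundedNearTop_axis_of_zoom x₀ hx₀ hδ fun α β R q hα hβ hR hloc hr2 hmaps => ?_
  refine isRegularAtOrigin_of_poloidalAxisDecay hloc hr2
    ⟨α / R * M, ae_swirlBound_axis_zoom hx₀ hα hR hM fun z hz => (hmaps z hz).1⟩ ⟨α / R * C, ?_⟩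
  refine (ae_restrict_mem (isOpen_parCyl 0 1).measurableSet).mono fun z hz => ?_
  obtain ⟨hτ, htδ, hball⟩ := hmaps z hz
  have hbd := hpol _ hτ htδ _ hball
  have hfun : (α • stPull β R T x₀ u) z.1 = fun y' => α • u (T + β * z.1) (x₀ + R • y') := by
    funext y'; rfl
  rw [hfun, poloidalPart_axis_zoom hx₀ hR, norm_smul, Real.norm_of_nonneg hα.le]
  have hrad : cylRadius (x₀ + R • z.2) = R * cylRadius z.2 := by
    rw [cylRadius_axis_add_smul h0 h1 R z.2, abs_of_pos hR]
  rw [hrad] at hbd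
  calc cylRadius z.2 * (α * ‖poloidalPart (u (T + β * z.1)) (x₀ + R • z.2)‖)
      = α / R * (R * cylRadius z.2 * ‖poloidalPart (u (T + β * z.1)) (x₀ + R • z.2)‖) := by
        field_simp
    _ ≤ α / R * C := mul_le_mul_of_nonneg_left hbd (div_pos hα hR).le

/-- **Local kill form for Theorem 1.2** (classical, bounded swirl): a singular axis point sees
unbounded `|x'| ‖ū‖` in every parabolic neighbourhood. [cite: SereginSverak2009, Thm 1.2 (arXiv p. 3) with its hypothesis (p. 2)] -/
theorem SereginSverak2009.exists_cylRadius_mul_norm_poloidal_gt_near_axis_of_not_isBoundedNearTop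
    (H : AxisymmetricL3Hyp ν T u p) (x₀ : EuclideanSpace ℝ (Fin 3)) (hx₀ : cylRadius x₀ = 0)
    (hΓ : ∃ M : ℝ, ∀ t ∈ Ico 0 T, ∀ x, |swirl (u t) x| ≤ M) (hsing : ¬ IsBoundedNearTop u T x₀)
    {δ : ℝ} (hδ : 0 < δ) (C : ℝ) :
    ∃ t ∈ Ico 0 T, T - δ ^ 2 < t ∧ ∃ x ∈ ball x₀ δ,
      C < cylRadius x * ‖poloidalPart (u t) x‖ := by
  by_contra hcon
  push Not at hcon
  exact hsing (isBoundedNearTop_axis_of_localPoloidalAxisDecay_of_swirlBound H x₀ hx₀ hδ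
    (fun t ht htδ x hx => hcon t ht htδ x hx) hΓ)

/-- **Kill form for Theorem 1.2, sharpest classical reading**: at a genuine lifespan `T` of a
classical axisymmetric Leray–Hopf solution bounded on sub-slabs with `|Γ₀| ≤ M` there is an AXIS
POINT `x₀` with `|x'| ‖ū‖` unbounded in every parabolic neighbourhood of `(T, x₀)` (the global
form `exists_poloidal_axisDecay_gt_of_isMaximalSmoothSolution` is in `KNSSPoloidalAxisDecay`).
[cite: SereginSverak2009, Thm 1.2 (arXiv p. 3) with its hypothesis (p. 2); KochNadirashviliSereginSverak2009, Thm 6.1 and (1.9)] -/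
theorem SereginSverak2009.exists_axisPoint_poloidalAxisDecay_unbounded_of_isMaximalSmoothSolution
    (hν : 0 < ν) (hT : 0 < T) (hmax : IsMaximalSmoothSolution ν 0 u p T)
    (hLH : IsLerayHopfOn T ν 0 (u 0) u)
    (hbdd : ∀ T' < T, ∃ M : ℝ, ∀ t ∈ Icc 0 T', ∀ x, ‖u t x‖ ≤ M)
    (haxi : ∀ t ∈ Ico 0 T, IsAxisymmetric (u t)) (hΓ₀ : ∃ M : ℝ, ∀ x, |swirl (u 0) x| ≤ M) :
    ∃ x₀ : EuclideanSpace ℝ (Fin 3), cylRadius x₀ = 0 ∧ ∀ δ > 0, ∀ C : ℝ,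
      ∃ t ∈ Ico 0 T, T - δ ^ 2 < t ∧ ∃ x ∈ ball x₀ δ,
        C < cylRadius x * ‖poloidalPart (u t) x‖ := by
  by_contra hcon
  push Not at hcon
  have H : AxisymmetricL3Hyp ν T u p := ⟨hν, hT, hmax.1, hLH, hbdd, haxi⟩
  obtain ⟨M, hM⟩ := hΓ₀
  have hΓ : ∃ M : ℝ, ∀ t ∈ Ico 0 T, ∀ x, |swirl (u t) x| ≤ M :=
    ⟨M, abs_swirl_le_of_classical_Ico hν hmax.1 haxi hbdd hM⟩
  have hloc : ∀ x₀ : EuclideanSpace ℝ (Fin 3), IsBoundedNearTop u T x₀ := fun x₀ => by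
    by_cases hx₀ : cylRadius x₀ = 0
    · obtain ⟨δ, hδ, C, hC⟩ := hcon x₀ hx₀
      exact isBoundedNearTop_axis_of_localPoloidalAxisDecay_of_swirlBound H x₀ hx₀ hδ
        (fun t ht htδ x hx => hC t ht htδ x hx) hΓ
    · exact axisymmetricL3_boundedNearTop_offAxis H x₀ hx₀
  obtain ⟨R, r₁, K₁, hr₁, hfar⟩ := axisymmetricL3_boundedNearTop_infinity H
  obtain ⟨r₀, hr₀, K, hK⟩ := exists_bound_final_slab hloc hr₁ hfar
  exact hmax.2 (hasSmoothExtensionPast_of_bounded_holds hν hT hmax.1 hLH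
    (exists_bound_Ico_of_final_slab hbdd hr₀ hK))

/-! ### `ns.S24` with the hypotheses on the poloidal velocity: one name for KILLSHEET K8 -/

/-- **No axisymmetric Type I blow-up, hypotheses on the POLOIDAL velocity only** — the sibling of
the tree's `knss_no_axisymmetric_typeI` (KNSS 2009 Thms 6.1–6.2 / Seregin–Šverák 2009 Thms 1.1–1.2,
DISCHARGED as `knss_no_axisymmetric_typeI_holds` with the bounds on the full velocity) in the form
Seregin–Šverák print it ("the Type I bound is needed on the meridional part `v̄` only", §1 p. 2),
for classical data with `Γ₀ = ϱ u₀^θ ∈ L^∞`: a classical axisymmetric Leray–Hopf solution on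
`[0, T)`, bounded on sub-slabs, with `|Γ₀| ≤ M` and EITHER the Type I rate on `ū`
(`IsTypeIBlowup (t x ↦ ū(t,x)) T`) OR `|x'| ‖ū(t,x)‖ ≤ C` on `[0,T) × ℝ³`, extends smoothly past
`T` (`hasSmoothExtensionPast_of_isTypeIBlowup_poloidal`, `hasSmoothExtensionPast_of_poloidal_axisDecay`).
[cite: SereginSverak2009, Thms 1.1–1.2 (arXiv p. 3) with their hypotheses (p. 2); KochNadirashviliSereginSverak2009, Thms 6.1–6.2 and (1.9)] -/
theorem knss_no_axisymmetric_typeI_poloidal (hν : 0 < ν) (hT : 0 < T)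
    (h : IsClassicalNSSolutionOn (Ico 0 T) ν 0 u p) (hLH : IsLerayHopfOn T ν 0 (u 0) u)
    (hbdd : ∀ T' < T, ∃ M : ℝ, ∀ t ∈ Icc 0 T', ∀ x, ‖u t x‖ ≤ M)
    (haxi : ∀ t ∈ Ico 0 T, IsAxisymmetric (u t)) (hΓ₀ : ∃ M : ℝ, ∀ x, |swirl (u 0) x| ≤ M)
    (htypeI : IsTypeIBlowup (fun t x => poloidalPart (u t) x) T ∨
      ∃ C : ℝ, ∀ t ∈ Ico 0 T, ∀ x, cylRadius x * ‖poloidalPart (u t) x‖ ≤ C) :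
    HasSmoothExtensionPast ν 0 u T := by
  rcases htypeI with hI | hpol
  · exact hasSmoothExtensionPast_of_isTypeIBlowup_poloidal hν hT h hLH hbdd haxi hΓ₀ hI
  · exact hasSmoothExtensionPast_of_poloidal_axisDecay hν hT h hLH hbdd haxi hΓ₀ hpol

/-- **The same for a rapidly decaying datum** (`Γ₀ ∈ L^∞` automatically).
[cite: SereginSverak2009, Thms 1.1–1.2 (arXiv p. 3); KochNadirashviliSereginSverak2009, Thms 6.1–6.2] -/
theorem knss_no_axisymmetric_typeI_poloidal_of_rapidDecay (hν : 0 < ν) (hT : 0 < T)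
    (h : IsClassicalNSSolutionOn (Ico 0 T) ν 0 u p) (hLH : IsLerayHopfOn T ν 0 (u 0) u)
    (hbdd : ∀ T' < T, ∃ M : ℝ, ∀ t ∈ Icc 0 T', ∀ x, ‖u t x‖ ≤ M)
    (haxi : ∀ t ∈ Ico 0 T, IsAxisymmetric (u t)) (hdecay : HasRapidSpatialDecay (u 0))
    (htypeI : IsTypeIBlowup (fun t x => poloidalPart (u t) x) T ∨
      ∃ C : ℝ, ∀ t ∈ Ico 0 T, ∀ x, cylRadius x * ‖poloidalPart (u t) x‖ ≤ C) :
    HasSmoothExtensionPast ν 0 u T :=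
  knss_no_axisymmetric_typeI_poloidal hν hT h hLH hbdd haxi hdecay.abs_swirl_le htypeI

end Classical

end Literature.Analysis.FluidPDE
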